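import Mathlib
import Summits.NavierStokesRegularity.NavierStokesRegularity.Theorems.DssFarFieldSlavingBlowupTypeIDssProfileSimilarityEnstrophyTimeThreshold
import Summits.NavierStokesRegularity.NavierStokesRegularity.Theorems.DssFarFieldSlavingBlowupTypeIDssProfileSmoothRepresentativeAe
import Literature.Analysis.FluidPDE.TypeIAncientMildDecay
import HarnessLib

/-!
# E3′(time): the TIME-CONSTANT PORTRAIT FLOOR at CLASS level, UNCONDITIONALLY — the time-only
  constant of every survivor's KNSS representative is `≥ 1` at EVERY space–time Type-I level
  (pub-ns-dss T38/T31 scope «Row 2′»; theory EXPLICIT-THRESHOLDS row T31″ HEADLINE «M_t < 1 ⇒ u ≡ 0,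
  any M»; route `DssFarFieldSlaving`, crux `BlowupTypeIDssProfile`, stmt-NavierStokesRegularity-0155 —
  SUPPORT; typer seat g8, 2026-08-24)

HONEST FRAMING. Exclusion statements about a HYPOTHETICAL object (a KNSS-gauge Type-I field / a member
of the rotated-DSS Type-I class). The tree already holds (i) the classical T31″ theorem under (D)
(`typeI_ancient_eq_zero_of_typeI_lt_one`, Row 2, p363433), (ii) the (D) ⇒ T31″-hypothesis bridge
`timeThreshold_hypothesis_of_decay` (same file: for ANY space–time level `C₀`, a KNSS-gauge field with
`HasTypeIDecay C₀ V` and TIME-ONLY constant `√(−t)‖V(t,x)‖ ≤ θ`, `θ < 1`, vanishes — GIVEN (D)), and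
(iii) the Literature theorem `IsTypeIAncientMild.gaugeBounds_of_hasTypeIDecay` that IS (D) (p365047; used
by the (D)-discharge p366221 for the class constant `M < 1`). This file only COMPOSES them: the classical
statement «time-only constant `θ < 1` at ANY space–time level `C₀` ⇒ `V ≡ 0`» holds with NO named input
(`typeI_ancient_eq_zero_of_timeConstant_lt_one`), and at CLASS level the ∀-representative PORTRAIT FLOOR
(`rdssClass_empty_of_timeConstant`, the shape of Row 4's `GaussianGap.rdssClass_empty_of_twoConstant`
with the space constant dropped): at EVERY space–time level `M`, no non-trivial member has all its smooth
KNSS representatives with time-only constant `θ < 1` — every survivor has `M_t := sup √(−t)‖V‖ ≥ 1`,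
which is SHARPER than the landed class label «EVERY `M < 1`» (`SimilarityEnstrophy.rdssClass_empty_of_typeI_lt_one`:
the space–time constant `M` dominates `M_t`) and is the theory seat's DERIVED HEADLINE of row E3
(«every non-trivial member has `sup_t √(−t)‖u(t)‖_∞ ≥ 1`») in the class's own currency. MECHANISM:
unchanged (Row 2: the UNWEIGHTED similarity enstrophy, `Z′ ≤ −½(1 − θ²)Z`). DSS-BLIND: `c`, `R`,
`IsRotatedDSS` are discarded. No threshold is claimed sharp. Census words on ACCEPT, if any, are the
lead's; the «EVERY `M < 1` — UNCONDITIONAL» label stays the discharge's (p366221) and is not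
re-attributed here. Nothing numeric about any candidate; nothing here bears on Navier–Stokes regularity
or blow-up.
-/

noncomputable section

set_option linter.dupNamespace false

namespace Summit.NavierStokesRegularity.NavierStokesRegularity.Theorems.SimilarityEnstrophy

open MeasureTheory Set Filter Topology InnerProductSpace Function
open scoped RealInnerProductSpace ContDiff
open Literature.Analysis Literature.Analysis.FluidPDE
open Summit.NavierStokesRegularity.NavierStokesRegularity.Theorems

/-- **T31″ for the TIME-ONLY constant at ANY space–time level, CLASSICAL, UNCONDITIONAL.** A KNSS-gauge
Type-I field `V` with the space–time envelope `HasTypeIDecay C₀ V` (any `C₀`) whose time-only constant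
satisfies `√(−t) ‖V(t,x)‖ ≤ θ` for all `t < 0`, `x` with `θ < 1` vanishes on `t < 0`: the tree's bridge
`timeThreshold_hypothesis_of_decay` fed with the Literature theorem
`IsTypeIAncientMild.gaugeBounds_of_hasTypeIDecay` (Chae–Wolf 2017 (3.6) / Pineau–Vicol 2026 (7.2),
class-uniform) — a term, no new analysis. [this file; theory T31″ headline; nothing here bears on NS
regularity] -/
theorem typeI_ancient_eq_zero_of_timeConstant_lt_one {C₀ θ : ℝ}
    {V : ℝ → EuclideanSpace ℝ (Fin 3) → EuclideanSpace ℝ (Fin 3)} (hθ : θ < 1)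
    (hV : IsTypeIAncientMild C₀ V) (hdec : HasTypeIDecay C₀ V)
    (hb : ∀ t < 0, ∀ x, Real.sqrt (-t) * ‖V t x‖ ≤ θ) :
    ∀ t < 0, ∀ x, V t x = 0 :=
  timeThreshold_hypothesis_of_decay IsTypeIAncientMild.gaugeBounds_of_hasTypeIDecay hθ hV hdec hb

/-- **The TIME-CONSTANT PORTRAIT FLOOR at CLASS level, UNCONDITIONAL** (∀-representative shape of Row 4's
`GaussianGap.rdssClass_empty_of_twoConstant` with the space constant dropped): at EVERY space–time
Type-I level `M`, no non-trivial member of the hypothesis class of `RdssProfileTruncation` (any `c > 1`,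
ANY twist `R ∈ O(3)`) has all its smooth KNSS representatives (`IsTypeIAncientMild M V`, `V(t) = u(t)`
a.e.) with time-only constant `θ < 1` (`√(−t) ‖V(t,x)‖ ≤ θ`) — every survivor's representative has
`sup √(−t)‖V‖ ≥ 1`, whatever its space–time constant `M ≥ 1` (for `M < 1` the class is already EMPTY:
`rdssClass_empty_of_typeI_lt_one`). Proof: a smooth representative exists
(`typeI_ancient_smoothRepresentative_ae`), carries `HasTypeIDecay M V`, and vanishes by
`typeI_ancient_eq_zero_of_timeConstant_lt_one`. DSS-blind. [this file; theory T31″ headline («every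
non-trivial member has `M_t ≥ 1`», any `M`); census words on ACCEPT, if any, are the lead's; nothing
numerical is asserted and nothing here bears on NS regularity] -/
theorem rdssClass_empty_of_timeConstant (M : ℝ) {θ : ℝ} (hθ : θ < 1) :
    ¬ ∃ (c : ℝ) (R : (EuclideanSpace ℝ (Fin 3)) ≃ₗᵢ[ℝ] (EuclideanSpace ℝ (Fin 3)))
        (u : ℝ → (EuclideanSpace ℝ (Fin 3)) → (EuclideanSpace ℝ (Fin 3))),
      1 < c ∧ IsAncientMildSolution 1 u ∧ (∀ t < 0, AEStronglyMeasurable (u t) volume) ∧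
      IsRotatedDSS c R u ∧ HasTypeIDecay M u ∧
      (∀ V : ℝ → EuclideanSpace ℝ (Fin 3) → EuclideanSpace ℝ (Fin 3), IsTypeIAncientMild M V →
        (∀ t < 0, V t =ᵐ[volume] u t) → ∀ t < 0, ∀ x, Real.sqrt (-t) * ‖V t x‖ ≤ θ) ∧
      ¬ (∀ t < 0, u t =ᵐ[volume] 0) := by
  rintro ⟨c, R, u, -, hmild, hmeas, -, hdec, hrep, hne⟩
  obtain ⟨V, hT, hdecV, hVu, -⟩ := typeI_ancient_smoothRepresentative_ae hmild hmeas hdec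
  have hz : ∀ t < 0, ∀ x, V t x = 0 :=
    typeI_ancient_eq_zero_of_timeConstant_lt_one hθ hT hdecV (hrep V hT hVu)
  refine hne fun t ht => ?_
  have hVz : V t = 0 := funext fun x => by simpa using hz t ht x
  exact (hVu t ht).symm.trans (Filter.EventuallyEq.of_eq hVz)

end Summit.NavierStokesRegularity.NavierStokesRegularity.Theorems.SimilarityEnstrophy
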